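import Literature.AlgebraicGeometry.Resolution.AffineBlowupCartier
import Literature.AlgebraicGeometry.Resolution.SchematicallyDense
import HarnessLib

/-!
# Morphisms to the affine blowing up are unique (uniqueness half of GW Prop. 13.92)

Topic: `Literature/AlgebraicGeometry/Resolution`. The uniqueness half of the universal property
(`IsBlowup.universal`, `Blowups.lean`; Görtz–Wedhorn I, Def. 13.90 / Prop. 13.92; Stacks 0806)
for the CONSTRUCTED blowing up `affineBlowup.π I : Bl_I(Spec R) = Proj R[It] → Spec R` of
`AffineBlowup.lean` along the ideal sheaf `affineBlowup.idealSheaf I` of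
`AffineBlowupCartier.lean` — PROVED: two morphisms `g₁ g₂ : W → Bl_I(Spec R)` over `Spec R`
from a scheme `W` on which `Ĩ` pulls back to an effective Cartier divisor coincide. Proof as in
Görtz–Wedhorn's argument for Prop. 13.91 (4) / 13.92: `g₁` and `g₂` agree over
`Spec R ∖ V(I)`, where the blowing up is an isomorphism
(`affineBlowup.isIso_morphismRestrict_iSup`, `AffineBlowup.lean`), i.e. on the complement of the
effective Cartier divisor `f⁻¹ V(I) ⊆ W`, which is schematically dense, and `Bl_I(Spec R)` is
separated over `Spec R` (`IsEffectiveCartier.ext_of_isSeparated`, `SchematicallyDense.lean`,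
GW Prop. 9.19). Together with `affineBlowup.isEffectiveCartier_exceptionalIdeal`
(`AffineBlowupCartier.lean`) this leaves only the EXISTENCE of the lift (gluing of the charts
`A[I/f]`, GW p. 415) to obtain `IsBlowup (affineBlowup.π I) (affineBlowup.idealSheaf I)`.

* `affineBlowup.support_idealSheaf` — the support of `Ĩ` is `V(I)`;
* `affineBlowup.hom_ext` — the uniqueness statement.

## Sources

* U. Görtz, T. Wedhorn, *Algebraic Geometry I*, 2nd ed. (2020): (13.19), Def. 13.90,
  Prop. 13.91 (4) (proof), Prop. 13.92 (proof, "final object"); Prop. 9.19.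
-/

noncomputable section

open CategoryTheory CategoryTheory.Limits AlgebraicGeometry TopologicalSpace

namespace Literature.AlgebraicGeometry.Resolution

universe u

variable {R : Type u} [CommRing R] (I : Ideal R)

/-- The support of the ideal sheaf `Ĩ` of `I` on `Spec R` is the zero locus `V(I)`.
[folklore] -/
theorem affineBlowup.support_idealSheaf :
    ((affineBlowup.idealSheaf I).support : Set (Spec (.of R))) =
      PrimeSpectrum.zeroLocus (I : Set R) := by
  rw [affineBlowup.idealSheaf, Scheme.IdealSheafData.coe_support_ofIdealTop, Ideal.map,
    Scheme.zeroLocus_span]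
  exact Spec_zeroLocus_eq_zeroLocus (R := .of R) (I : Set R)

/-- **Uniqueness of morphisms to the blowing up** (the uniqueness half of the universal
property of `Bl_I(Spec R)`, Görtz–Wedhorn I, Def. 13.90 with Prop. 13.92): if
`f : W → Spec R` pulls `Ĩ` back to an effective Cartier ideal sheaf, any two morphisms
`g₁ g₂ : W → Bl_I(Spec R)` with `gᵢ ≫ π = f` are equal — they agree over `Spec R ∖ V(I)`, where
`π` is an isomorphism, hence on the schematically dense complement of the effective Cartier
divisor `f⁻¹ V(I)`, and `π` is separated. [cite: GortzWedhorn2020, Prop. 13.92 (proof)] -/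
theorem affineBlowup.hom_ext {W : Scheme.{u}} (f : W ⟶ Spec (.of R))
    (hf : IsEffectiveCartier ((affineBlowup.idealSheaf I).comap f))
    {g₁ g₂ : W ⟶ affineBlowup I}
    (h₁ : g₁ ≫ affineBlowup.π I = f) (h₂ : g₂ ≫ affineBlowup.π I = f) : g₁ = g₂ := by
  refine hf.ext_of_isSeparated (affineBlowup.π I) (h₁.trans h₂.symm) ?_
  -- the open `O = Spec R ∖ V(I)` over which `π` is an isomorphism, and `U = f⁻¹ O`
  set O : (Spec (CommRingCat.of R)).Opens := ⨆ a : I, PrimeSpectrum.basicOpen (a : R) with hOdef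
  haveI hO : IsIso (affineBlowup.π I ∣_ O) := affineBlowup.isIso_morphismRestrict_iSup
  set U : W.Opens := ⟨(((affineBlowup.idealSheaf I).comap f).support : Set W)ᶜ,
    ((affineBlowup.idealSheaf I).comap f).support.isClosed.isOpen_compl⟩ with hUdef
  have hUO : ∀ u : U, f u.1 ∈ O := by
    intro u
    have hu : u.1 ∉ (((affineBlowup.idealSheaf I).comap f).support : Set W) := u.2
    rw [Scheme.IdealSheafData.support_comap] at hu
    change f u.1 ∉ ((affineBlowup.idealSheaf I).support : Set _) at hu
    rw [affineBlowup.support_idealSheaf] at hu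
    change f u.1 ∈ (O : Set _)
    exact (Set.ext_iff.mp (iSup_basicOpen_eq_compl_zeroLocus (R := R) (I := I)) (f u.1)).mpr hu
  -- both `U.ι ≫ gᵢ` land in `π⁻¹ O`
  have hrange : ∀ {g : W ⟶ affineBlowup I}, g ≫ affineBlowup.π I = f →
      Set.range (U.ι ≫ g) ⊆ Set.range (affineBlowup.π I ⁻¹ᵁ O).ι := by
    intro g hg
    rintro _ ⟨u, rfl⟩
    rw [Scheme.Opens.range_ι]
    change affineBlowup.π I ((U.ι ≫ g) u) ∈ O
    rw [← Scheme.Hom.comp_apply, Category.assoc, hg, Scheme.Hom.comp_apply]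
    exact hUO u
  -- the lifts to `π⁻¹ O` agree after the isomorphism `π⁻¹ O ≅ O`, hence agree
  have key : ∀ {g : W ⟶ affineBlowup I} (hg : g ≫ affineBlowup.π I = f),
      IsOpenImmersion.lift _ _ (hrange hg) ≫ (affineBlowup.π I ∣_ O) ≫ O.ι = U.ι ≫ f := by
    intro g hg
    rw [morphismRestrict_ι, IsOpenImmersion.lift_fac_assoc, Category.assoc, hg]
  have hl : IsOpenImmersion.lift _ _ (hrange h₁) = IsOpenImmersion.lift _ _ (hrange h₂) := by
    rw [← cancel_mono ((affineBlowup.π I ∣_ O) ≫ O.ι), key h₁, key h₂]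
  calc U.ι ≫ g₁ = IsOpenImmersion.lift _ _ (hrange h₁) ≫ (affineBlowup.π I ⁻¹ᵁ O).ι :=
        (IsOpenImmersion.lift_fac _ _ _).symm
    _ = IsOpenImmersion.lift _ _ (hrange h₂) ≫ (affineBlowup.π I ⁻¹ᵁ O).ι := by rw [hl]
    _ = U.ι ≫ g₂ := IsOpenImmersion.lift_fac _ _ _

end Literature.AlgebraicGeometry.Resolution
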